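import Summits.CriticalPhenomena.Ising3D.Control2DL11TwoSided037
import Summits.CriticalPhenomena.Ising3D.Control2DL11GapA
import Mathlib.Tactic.NormNum
import HarnessLib

/-!
# The kernel-complete two-sided 2D statements with the Λ = 11 gap: `Δ_ε < 1.0006` at `Δ_σ = 1/8` under `A2D′`
(cell `pub-ising3x`, seat controls-1 gen 16/17; KERNEL PATH for the 2D γ-certificates, Λ = 11 — CONTROL-ONLY)

HONEST FRAMING: lottery ticket; floor = tightest certified 3D Ising CFT bounds; no exact-solution
claim without a proof. CONTROL-ONLY (`d = 2`, `Δ_σ = 1/8`, axiom set `A2D′`); nothing about `d = 3`; weaker than the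
reader-certified statement of record (`0.99 < Δ_ε < 1.00005`, Λ = 19).

* `twoSided_2d_L11_kernel_sharp : TwoSided (1/8) 2 1 (2/5) (43/50) (5003/5000)` — the cover `excludedOn_2d_L11_cover`
  (RB-2 boxes D–G) with the kernel-complete RB-1 Λ = 11 gap certificate `gapExcluded_2d_L11_gapA : GapExcluded (1/8) (5003/5000)`
  (j106899) in place of the Λ = 7 one (`201/200`);
* `twoSided_2d_L11_kernel037_sharp : TwoSided (1/8) 2 1 (37/100) (181/200) (5003/5000)` — the same with the full
  Λ = 11 cover `excludedOn_2d_L11_cover037` (boxes B–J): under `A2D′` at `Δ_σ = 1/8` an `ε` location `x ≥ 0.37` lies in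
  `(0.905, 1.0006)` — Λ = 11 on BOTH sides, every inequality re-decided by the Lean kernel. No facts, standard axioms only.
-/

namespace Summit.CriticalPhenomena.Ising3D.Control2D

open Set
open Literature.MathematicalPhysics.QuantumFieldTheory.ConformalBootstrap3D

/-- **2D control, class 1, kernel-complete, Λ = 11 on both sides**: under `A2D′` at `Δ_σ = 1/8` an `ε` location
`x ≥ 2/5` satisfies `43/50 < x < 5003/5000`. CONTROL-ONLY (d = 2). [cite: RattazziEtAl2008, §5.5] -/
theorem twoSided_2d_L11_kernel_sharp : TwoSided (1 / 8 : ℝ) 2 1 (2 / 5) (43 / 50) (5003 / 5000) :=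
  twoSided_of_cover excludedOn_2d_L11_cover gapExcluded_2d_L11_gapA (by norm_num)

/-- **2D control, class 1, kernel-complete, full Λ = 11 window and Λ = 11 gap**: under `A2D′` at `Δ_σ = 1/8` an
`ε` location `x ≥ 37/100` satisfies `181/200 < x < 5003/5000`. CONTROL-ONLY (d = 2). [cite: RattazziEtAl2008, §5.5] -/
theorem twoSided_2d_L11_kernel037_sharp : TwoSided (1 / 8 : ℝ) 2 1 (37 / 100) (181 / 200) (5003 / 5000) :=
  twoSided_of_cover excludedOn_2d_L11_cover037 gapExcluded_2d_L11_gapA (by norm_num)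

end Summit.CriticalPhenomena.Ising3D.Control2D
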